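import Literature.NumberTheory.LFunctions.LogDerivAtOneQuasiZeroFree
import Literature.NumberTheory.LFunctions.DirichletLogDerivDisc
import Literature.NumberTheory.DiophantineGeometry.AbcWave0
import HarnessLib

/-!
# Explicit inequalities between `Re L'/L(1, χ)` and sums over zeros near `s = 1`
# (Táfula, Acta Arith. 201 (2021), §3: Propositions 3.1, 3.2; §1.2 Corollary 1.5)

Topic `Literature/NumberTheory/LFunctions` (namespace `Literature.NumberTheory.LFunctions`, paper
vocabulary in `Tafula2021`). Typed for the cell `landau-siegel` (LANDAU–SIEGEL PROGRAMME, rung F-S3,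
sub-cell §C literature harvest, reader r6, rows r6-T11/T12), statement-first (D-0014/D-0064: ONE
file for the paper's §3 «On `Re(L'/L(1, χ))` and zeros near `s = 1`», plus the corollary of §1.2
that it feeds). The explicit, UNCONDITIONAL engine of Táfula's two papers lives here:

* `tafula2021_proposition31` — for ANY finite set `𝒮` of non-trivial zeros (with multiplicity),
  `∑_{ρ ∈ 𝒮} Re(1/(1 − ρ)) < (1 − 1/√5)·½·log q + Re(L'/L(1, χ)) + (1 + 1/√5)(2|𝒮| + 3)/2 − 1`
  (every primitive `χ` mod `q ≥ 2`; no error term, no `q₀`);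
* `tafula2021_proposition32` — `|Re(L'/L(1, χ) − ∑_{ρ ∈ Z(χ) ∩ ℬ_f} 1/(1 − ρ))| <
  (14.5 + 2|Z(χ) ∩ ℬ_f|) √(f(q) log q)` for the Page box `ℬ_f(q) = {σ > 1 − 1/f(q), |t| < 1/√f(q)}`,
  `2 ≤ f(q) ≤ 4 log q`;
* `tafula2021_corollary15` — weak uniform `abc` ⟹ `L(σ, χ_D) ≠ 0` on
  `[1 − 1/((√5·φ + o(1)) log |D|), 1]`, `D → −∞`, `φ = (1 + √5)/2` (first assertion only);

and PROVED consequences: the single-real-zero dictionary with explicit constants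
(`Tafula2021.one_div_sub_lt`), the explicit unconditional lower bound
`Re L'/L(1, χ) > −0.2764·log q − 1.171` for EVERY `q ≥ 2` (`Tafula2021.neg_logDeriv_one_lt`), and
the implication to the asymptotic named fact of the 2025 paper
(`Tafula2021.tafula2025_remark23_of_proposition31`, so discharging `tafula2021_proposition31`
discharges `tafula2025_remark23` too). Theorem 1.3 of the paper (= Proposition 3.1 + the log-free
zero count `|Z(χ) ∩ ℛ_A| ≪ e^{3A}` of Iwaniec–Kowalski ch. 18) and Theorems 1.1/1.2/1.4 (heights
of singular moduli; Chang's regions) are NOT typed here; the `abc ⟹ no Siegel zero` implications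
themselves are in the tree already — `Literature.NumberTheory.DiophantineGeometry.granville_stark_noSiegelZeros_holds`,
`Literature.Barriers.ABC.OWeakUniformABCImpliesNoSiegelZeros_holds` (CITED, not retyped) — and this
file only adds the EXPLICIT constant `√5·φ` of Corollary 1.5 under the WEAK (little-`o`)
uniformity, which those entries record as prose only.

Source. C. Táfula, *On Landau–Siegel zeros and heights of singular moduli*, Acta Arith. **201**
(2021), 1–28, doi:10.4064/aa191118-18-5; held as arXiv:1911.07215 (`paper:arxiv-1911.07215`,
corpus TeX, 16 chunks, read 2026-08-26; locators `pNNNN:Lm` = chunk:line; the arXiv numbering is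
used, as in the tree's other citations of this paper).

## What the source says (verbatim where it matters; lost TeX macros restored from the proofs)

* §3 (p0006:L3): «Consider primitive characters `χ (mod q)` for `q ≥ 2`, and write `Z(χ)` for the
  set of non-trivial zeros of `L(s, χ)` counted with multiplicity.»
* **Proposition 3.1** (p0006:L5–L7). «Let `𝒮` be any finite subset of non-trivial zeros of
  `L(s, χ)` (including the empty set). Then:
  `∑_{ρ ∈ 𝒮} Re(1/(1 − ρ)) < (1 − 1/√5)·½·log q + Re(L'/L(1, χ)) + (1 + 1/√5)·(2|𝒮| + 3)/2 − 1`.»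
  (Proof, p0007:L80–L93, last line: `… − (1 − 1/√5)·½·log q − (√5 + 1)(2|𝒮| + 3)/(2√5) + 1`,
  which is the displayed constant.)
* **Proposition 3.2** (p0006:L9–L14). «Consider the region
  `ℬ_f(q) := {s ∈ ℂ : σ > 1 − 1/f(q), |t| < 1/√f(q)}`, where `f : ℤ_{≥2} → ℝ` satisfies
  `2 ≤ f(q) ≤ 4 log q`. Then:
  `|Re(L'/L(1, χ) − ∑_{ρ ∈ Z(χ) ∩ ℬ_f} 1/(1 − ρ))| < (14.5 + 2|Z(χ) ∩ ℬ_f|)·√(f(q) log q)`.»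
  (Proof, p0007:L95–L105: `S₁, S₂, S₃` with `ε = 1/√(M log q)`, giving
  `(7/2 + 2|Z ∩ ℬ|)√(M log q) + (5M + 1)`, and «taking `M := f(q)` (`≤ 4 log q`), we have
  `f(q) ≤ 2√(f(q) log q)`», whence `14.5 = 7/2 + 11`; the box height `1/√M` is the complement of
  the proof's region `ℛ₃ = {|t| ≥ 1/√M}`, p0007:L40–L42.)
* «Theorem 1.3 follows directly from Proposition 3.1 together with the classical log-free
  zero-density estimate … `|Z(χ) ∩ {σ ≥ 1 − A/log q, |t| ≤ 1}| ≪ e^{cA}`, where we can take `c = 3`»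
  (p0006:L17–L18) — not typed.
* §5.1, **Conjecture 5.1** (abc for a number field `K`): «For every `ε > 0`, there is a constant
  `𝒞 = 𝒞_{K,ε} ≥ 0` such that, for any `a, b, c ∈ K` with `a + b + c = 0`:
  `ht(a:b:c) < (1 + ε)(𝒩_K(a:b:c) + log rd_K) + 𝒞_{K,ε}`» (p0012:L14–L19), `rd_K = |Δ_K|^{1/[K:ℚ]}`,
  `ht` the absolute logarithmic height and `𝒩_K` the logarithmic conductor of §2.3 (p0005);
  **Conjecture 5.2 (Uniformity)** (p0012:L25–L31): «(i) (`O`-weak uniform abc)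
  `𝒞_{K,ε} = O_ε(log rd_K)`. (ii) (Weak uniform abc) `𝒞_{K,ε} = o_ε(log rd_K)` as `rd_K → +∞`.
  (iii) (Uniform abc) `𝒞_{K,ε} = O_ε(1)`.»
* **Corollary 1.5** (p0003:L77–L80). «Assume the weak uniform abc-conjecture. As `D → −∞`, the
  function `L(s, χ_D)` has no zeros in the real interval `[1 − 1/((√5·φ + o(1)) log |D|), 1]`
  where `φ := (1 + √5)/2`, nor in the region … when `D` is `|D|^δ`-smooth for given `δ > 0`.»
  (Proof of the first assertion, §3.4 p0008:L15–L19: Proposition 3.1 with `𝒮 = {s}` gives, for a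
  zero `s = σ + it`, `1 > ((1 − σ) + t²/(1 − σ))·X`, `X := (1 − 1/√5)·½·log|D| + L'/L(1, χ_D) +
  O(1)`; «As `((1 − 1/√5)·½)^{−1} = √5·φ` … it follows from Theorem 1.2 that, under weak uniform
  abc, we have `X^{−1} > (√5·φ + o(1))^{−1}(log |D|)^{−1}`».) The second assertion (smooth `D`,
  with an unspecified absolute constant `m`) is NOT typed.

## Lean rendering / design choices

* Multiplicities: `m(ρ) = Literature.NumberTheory.LFunctions.DirichletDisc.zeroOrder χ ρ`
  (= `analyticOrderNatAt`, tree; `zeroOrder_pos_iff`: `m(ρ) > 0 ↔ L(ρ, χ) = 0`). A «finite subset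
  `𝒮` of `Z(χ)`» (a sub-multiset) is a `Finset ℂ` of non-trivial zeros (`0 < Re ρ < 1`) with
  integer weights `1 ≤ w ρ ≤ m(ρ)`; `|𝒮| = ∑ w`. `Z(χ) ∩ ℬ_f` is a `Finset` `S` characterised by
  `ρ ∈ S ↔ ρ ∈ ℬ_f(q) ∧ m(ρ) > 0`, each zero weighted by `m(ρ)` (zeros in `ℬ_f` are automatically
  non-trivial: `Re ρ > 1 − 1/f ≥ 1/2`, and `Re ρ < 1` for a zero).
* Proposition 3.2: only the value `f(q)` enters, so it is typed with a real parameter `F`,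
  `2 ≤ F ≤ 4 log q`, and the box `Tafula2021.pageBox F`.
* Weak uniform abc (`Tafula2021.WeakUniformABCAt ε`, the source's hypothesis being `∀ ε > 0`):
  item 5.1 for EVERY number field `K`
  together with (ii), in the relative multiplicative normalisation of the tree's
  `Literature.NumberTheory.DiophantineGeometry.UniformABCConjecture` (relative height
  `H_K = Height.mulHeight ![a,b,c]`, `|D_K| = rd_K^{[K:ℚ]}`, `radicalNorm a b c = exp([K:ℚ]·𝒩_K)`,
  `a + b = c` with `a, b, c ≠ 0` in place of `a + b + c = 0`): multiplying Conjecture 5.1 by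
  `[K:ℚ]` and exponentiating gives `H_K < C_K · (|D_K| · N_K)^{1+ε}` with `C_K = exp([K:ℚ]𝒞_{K,ε})`,
  and (ii) says: for every `η > 0` there is `R₀` with `C_K ≤ |D_K|^η` whenever `rd_K ≥ R₀`, i.e.
  `|D_K| ≥ R₀^{[K:ℚ]}`. This is Conjecture 5.1 ∧ 5.2(ii) exactly as printed (the asymptotic
  `rd_K → ∞` reading); it is NOT the `O`-weak all-`K` form `OWeakUniformABCImpliesNoSiegelZeros`
  uses as antecedent, and no implication between the two renderings is claimed here.
* Corollary 1.5 (first assertion): «as `D → −∞` … no zeros in `[1 − 1/((√5φ + o(1)) log|D|), 1]`»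
  is rendered `∀ ε > 0 ∃ q₀ ∀ q ≥ q₀`, every odd real primitive `χ` mod `q` (these are the `χ_D`,
  `D = −q < 0` fundamental) has `L(σ, χ) ≠ 0` for real `σ ≥ 1 − 1/((√5φ + ε) log q)`.

## Mathlib / tree search

`lean search 'proposition31|pageBox|WeakUniformABC|1911.07215'`: only docstring citations of
[Tafula2021] (Barriers/ABC/UniformABCImpliesNoSiegelZeros.lean, SiegelZeroLogDerivCriterion.lean,
AbcWave0.lean) — none of Propositions 3.1/3.2 or Corollary 1.5's constant is typed. Related PROVED
tree results with inexplicit constants: `ExceptionalZero.eta_le_of_logDeriv_le`,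
`exists_LFunction_ne_zero_of_logDeriv_le`, `neg_logDeriv_one_le` (SiegelZeroLogDerivCriterion.lean);
Heath-Brown's one-sided Lemma 3.1 (LogDerivOneSidedBounds.lean).

LABEL (cell rule): statement layer / literature harvest; tags DH (Props 3.1/3.2: explicit
dictionary «zeros in the Page box ↔ `Re L'/L(1, χ)`») and none (Cor 1.5: abc exit, odd
characters only — «Our proof provides no insight into … `d > 0`», Granville–Stark §1). WHAT THIS IS
NOT: no claim that weak uniform `abc` holds, and nothing about exceptional zeros themselves. «The
programme SEARCHES and TYPES; no claim about Landau–Siegel zeros, Theorems 1–2 of arXiv:2211.02515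
or a repaired Margin232 until a kernel theorem says so.»
-/

noncomputable section

open Complex Finset

namespace Literature.NumberTheory.LFunctions

open DirichletDisc

namespace Tafula2021

/-- The Page box `ℬ_f(q) = {σ + it : σ > 1 − 1/f(q), |t| < 1/√f(q)}` of
[cite: Tafula2021, Proposition 3.2 (arXiv p0006:L9–L11)], with the value `F = f(q)` as parameter
(the modulus `q` is implicit in `F`). -/
def pageBox (F : ℝ) : Set ℂ :=
  {s : ℂ | 1 - 1 / F < s.re ∧ |s.im| < 1 / Real.sqrt F}

/-- **The weak uniform `abc` hypothesis of §5, at level `ε`** = item 5.1 (abc for every number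
field `K`, with a field constant `𝒞_{K,ε}`) together with item 5.2 (ii) (`𝒞_{K,ε} = o_ε(log rd_K)`
as `rd_K → +∞`), in the relative multiplicative normalisation of the tree's uniform `abc`
statement abc.S21 of `AbcWave0.lean` (see the module docstring):
(5.1) each number field `K` has a constant `C_K` with `H_K(a:b:c) < C_K · (|D_K| · N_K(a,b,c))^{1+ε}`
for all nonzero `a + b = c` in `K`, and (ii) for every `η > 0` there is `R₀` such that
`C_K ≤ |D_K|^η` once `|D_K| ≥ R₀^{[K:ℚ]}` (i.e. `rd_K ≥ R₀`). A predicate in `ε` (the source's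
hypothesis is `∀ ε > 0, WeakUniformABCAt ε`); it is used only as an antecedent, in
`tafula2021_corollary15`. [cite: Tafula2021, §5.1, items 5.1 and 5.2(ii) (arXiv p0012:L14–L31)] -/
def WeakUniformABCAt (ε : ℝ) : Prop :=
  ∀ η : ℝ, 0 < η → ∃ R₀ : ℝ,
    ∀ (K : Type) [Field K] [NumberField K], ∃ C : ℝ,
      (R₀ ^ Module.finrank ℚ K ≤ (|NumberField.discr K| : ℝ) →
          C ≤ (|NumberField.discr K| : ℝ) ^ η) ∧
      ∀ a b c : K, a ≠ 0 → b ≠ 0 → c ≠ 0 → a + b = c →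
        Height.mulHeight ![a, b, c] <
          C * ((|NumberField.discr K| : ℝ) *
            (Literature.NumberTheory.DiophantineGeometry.radicalNorm a b c : ℝ)) ^ (1 + ε)

end Tafula2021

open Tafula2021

/-- **Táfula 2021, Proposition 3.1** (NAMED FACT, AS PRINTED — fully explicit, unconditional).
«Let `𝒮` be any finite subset of non-trivial zeros of `L(s, χ)` (including the empty set). Then:
`∑_{ρ ∈ 𝒮} Re(1/(1 − ρ)) < (1 − 1/√5)·½·log q + Re(L'/L(1, χ)) + (1 + 1/√5)·(2|𝒮| + 3)/2 − 1`»,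
for every primitive `χ` mod `q ≥ 2`, `Z(χ)` counted with multiplicity. Rendering: `𝒮` = a
`Finset` of zeros `ρ` with `0 < Re ρ < 1`, taken with integer weights `1 ≤ w ρ ≤ m(ρ)`
(`m = DirichletDisc.zeroOrder χ`), `|𝒮| = ∑ w ρ`.
[cite: Tafula2021, Proposition 3.1 (arXiv p0006:L5–L7; proof p0007:L80–L93)] -/
def tafula2021_proposition31 : Prop :=
  ∀ (q : ℕ) [NeZero q], 2 ≤ q → ∀ χ : DirichletCharacter ℂ q, χ.IsPrimitive →
    ∀ (S : Finset ℂ) (w : ℂ → ℕ),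
      (∀ ρ ∈ S, 0 < ρ.re ∧ ρ.re < 1 ∧ 1 ≤ w ρ ∧ w ρ ≤ zeroOrder χ ρ) →
        (∑ ρ ∈ S, (w ρ : ℝ) * (1 / (1 - ρ)).re) <
          (1 - 1 / Real.sqrt 5) / 2 * Real.log q + (deriv χ.LFunction 1 / χ.LFunction 1).re +
            (1 + 1 / Real.sqrt 5) * (2 * (∑ ρ ∈ S, (w ρ : ℝ)) + 3) / 2 - 1

/-- **Táfula 2021, Proposition 3.2** (NAMED FACT, AS PRINTED — fully explicit, unconditional).
«Consider the region `ℬ_f(q) := {s ∈ ℂ : σ > 1 − 1/f(q), |t| < 1/√f(q)}`, where `f : ℤ_{≥2} → ℝ`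
satisfies `2 ≤ f(q) ≤ 4 log q`. Then:
`|Re(L'/L(1, χ) − ∑_{ρ ∈ Z(χ) ∩ ℬ_f} 1/(1 − ρ))| < (14.5 + 2|Z(χ) ∩ ℬ_f|)·√(f(q) log q)`», for every
primitive `χ` mod `q ≥ 2`, zeros counted with multiplicity. Rendering: `F = f(q)` a real parameter;
`S` = the (finite) set of zeros of `L(s, χ)` in `pageBox F`, each weighted by its multiplicity
`m(ρ) = DirichletDisc.zeroOrder χ ρ`.
[cite: Tafula2021, Proposition 3.2 (arXiv p0006:L9–L14; proof p0007:L95–L105)] -/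
def tafula2021_proposition32 : Prop :=
  ∀ (q : ℕ) [NeZero q], 2 ≤ q → ∀ χ : DirichletCharacter ℂ q, χ.IsPrimitive →
    ∀ F : ℝ, 2 ≤ F → F ≤ 4 * Real.log q →
      ∀ S : Finset ℂ, (∀ ρ : ℂ, ρ ∈ S ↔ ρ ∈ pageBox F ∧ 0 < zeroOrder χ ρ) →
        |(deriv χ.LFunction 1 / χ.LFunction 1 -
            ∑ ρ ∈ S, (zeroOrder χ ρ : ℂ) * (1 / (1 - ρ))).re| <
          (14.5 + 2 * ∑ ρ ∈ S, (zeroOrder χ ρ : ℝ)) * Real.sqrt (F * Real.log q)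

/-- **ERRATUM (2026-08-27, cell `landau-siegel` §C, read against arXiv v3 = Acta Arith. 201 (2021)
TeX, l. 436–442): the printed interval of Corollary 1.5 is `[1 − (√5·φ + o(1))/log|D|, 1]`
(width `≈ 3.618/log|D|`, the constant in the NUMERATOR), not `[1 − 1/((√5·φ + o(1)) log|D|), 1]`
as glossed below (the held corpus-TeX chunk p0003:L78 lost the `\dfrac`); the proof (§3.4) gives
`1 − β > X⁻¹` with `X = ((1 − 1/√5)/2 + o(1)) log|D|` and `((1 − 1/√5)/2)⁻¹ = √5·φ`. The statement
below is therefore IMPLIED by the source (it is the printed one weakened by the factor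
`(√5φ + ε)(√5φ − ε′) > 1`) and is kept byte-identical for its importers; the faithful rendering is
`tafula2021_corollary15'` (`tafula2021_corollary15_of_corollary15'` derives this one from it).**

**Táfula 2021, Corollary 1.5, first assertion** (NAMED FACT — a THEOREM of the source, an
implication whose antecedent is the weak uniform `abc` hypothesis of §5). As printed: under weak
uniform `abc`, «As `D → −∞`, the function `L(s, χ_D)` has no zeros in the real interval
`[1 − 1/((√5·φ + o(1)) log |D|), 1]` where `φ := (1 + √5)/2`» — the EXPLICIT abc-conditional
constant (`√5·φ = 3.618…`, i.e. `c = 0.2763…` in `σ > 1 − c/log q`) that Granville–Stark's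
Theorem 2 (`Literature.NumberTheory.DiophantineGeometry.granville_stark_noSiegelZeros`) leaves
unspecified. Rendering: `(∀ ε > 0, WeakUniformABCAt ε) →` for every `ε > 0` and all large `q`, every
ODD real primitive `χ` mod `q` (the `χ_D`, `D = −q`) has `L(σ, χ) ≠ 0` for real
`σ ≥ 1 − 1/((√5·φ + ε) log q)`. Odd characters only; the second assertion (smooth `D`) is not
typed. [cite: Tafula2021, Corollary 1.5 (arXiv p0003:L77–L80; proof §3.4 p0008:L15–L19)] -/
def tafula2021_corollary15 : Prop :=
  (∀ ε : ℝ, 0 < ε → WeakUniformABCAt ε) →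
    ∀ ε : ℝ, 0 < ε → ∃ q₀ : ℝ, ∀ (q : ℕ) [NeZero q], q₀ ≤ (q : ℝ) →
      ∀ χ : DirichletCharacter ℂ q, χ.IsQuadratic → χ.IsPrimitive → χ.Odd →
        ∀ σ : ℝ, 1 - 1 / ((Real.sqrt 5 * ((1 + Real.sqrt 5) / 2) + ε) * Real.log q) ≤ σ →
          χ.LFunction σ ≠ 0

/-- **Táfula 2021, Corollary 1.5, first assertion — AS PRINTED** (NAMED FACT, the corrected
rendering of `tafula2021_corollary15`; a THEOREM of the source, conditional on the weak uniform
`abc` hypothesis of §5). «Assume the weak uniform `abc`-[hypothesis]. As `D → −∞`, the function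
`L(s, χ_D)` has no zeros in the real interval `[1 − (√5·φ + o(1))/log |D|, 1]` where
`φ := (1 + √5)/2`» — i.e. a zero-free real interval of width `(3.618… + o(1))/log|D|` below `1`
(Proposition 3.1 with `𝒮 = {β}` and Theorem 1.2 (ii), `L′/L(1, χ_D) = o(log|D|)`: `1 − β > X⁻¹`,
`X⁻¹ = (√5φ + o(1))/log|D|`, §3.4). Rendering of «`+ o(1)`» inside the excluded width: for every
`ε > 0` and all large `q`, every ODD real primitive `χ` mod `q` (the `χ_D`, `D = −q` fundamental) has
`L(σ, χ) ≠ 0` for real `σ ≥ 1 − (√5·φ − ε)/log q`. Odd characters only; the second assertion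
(smooth `D`) is not typed. Not proved here: the input Theorem 1.2 (ii) rests on Theorem 1.1
(`L′/L(1, χ_D) = ht(j(τ_D))/6 − ½ log|D| + C + o(1)`, via Duke's theorem), absent from the tree.
[cite: Tafula2021, Corollary 1.5 (Acta Arith. 201 (2021); arXiv v3 TeX l. 436–442; proof §3.4)] -/
def tafula2021_corollary15' : Prop :=
  (∀ ε : ℝ, 0 < ε → WeakUniformABCAt ε) →
    ∀ ε : ℝ, 0 < ε → ∃ q₀ : ℝ, ∀ (q : ℕ) [NeZero q], q₀ ≤ (q : ℝ) →
      ∀ χ : DirichletCharacter ℂ q, χ.IsQuadratic → χ.IsPrimitive → χ.Odd →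
        ∀ σ : ℝ, 1 - (Real.sqrt 5 * ((1 + Real.sqrt 5) / 2) - ε) / Real.log q ≤ σ →
          χ.LFunction σ ≠ 0

/-- The printed Corollary 1.5 implies the (narrower-interval) rendering `tafula2021_corollary15`:
`1/(√5φ + ε) ≤ √5φ − 1` since `√5φ > 2`, so `σ ≥ 1 − 1/((√5φ + ε) log q)` forces
`σ ≥ 1 − (√5φ − 1)/log q` once `log q > 0`. [cite: Tafula2021, Corollary 1.5] -/
theorem tafula2021_corollary15_of_corollary15' (h : tafula2021_corollary15') :
    tafula2021_corollary15 := by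
  intro habc ε hε
  obtain ⟨q₀, hq₀⟩ := h habc 1 one_pos
  refine ⟨max q₀ 2, fun q _ hq χ hquad hprim hodd σ hσ => ?_⟩
  have hq0 : q₀ ≤ (q : ℝ) := (le_max_left _ _).trans hq
  have hq2 : (2 : ℝ) ≤ (q : ℝ) := (le_max_right _ _).trans hq
  have hlog : 0 < Real.log q := Real.log_pos (by linarith)
  refine hq₀ q hq0 χ hquad hprim hodd σ (le_trans ?_ hσ)
  -- `1 − (√5φ − 1)/log q ≤ 1 − 1/((√5φ + ε) log q)`
  have h5 : (2 : ℝ) < Real.sqrt 5 := by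
    rw [show (2 : ℝ) = Real.sqrt (2 ^ 2) by rw [Real.sqrt_sq (by norm_num)]]
    exact Real.sqrt_lt_sqrt (by norm_num) (by norm_num)
  set Φ : ℝ := Real.sqrt 5 * ((1 + Real.sqrt 5) / 2) with hΦ
  have hΦ2 : 3 < Φ := by rw [hΦ]; nlinarith
  have hinv : 1 / ((Φ + ε) * Real.log q) ≤ (Φ - 1) / Real.log q := by
    rw [div_le_div_iff₀ (by positivity) hlog]
    have : Real.log q ≤ (Φ - 1) * (Φ + ε) * Real.log q := by
      have h1 : (1 : ℝ) ≤ (Φ - 1) * (Φ + ε) := by nlinarith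
      nlinarith
    linarith
  linarith

namespace Tafula2021

/-! ### Proved consequences of Proposition 3.1 -/

/-- A primitive character modulo `q ≥ 2` is not principal. [folklore] -/
private theorem ne_one_of_isPrimitive {q : ℕ} [NeZero q] (hq : 2 ≤ q) {χ : DirichletCharacter ℂ q}
    (hχ : χ.IsPrimitive) : χ ≠ 1 := by
  intro h1
  have hc := (DirichletCharacter.isPrimitive_def χ).mp hχ
  rw [h1, DirichletCharacter.conductor_one] at hc
  omega

/-- **Empty `𝒮`: an explicit unconditional lower bound for `Re L'/L(1, χ)`, valid for EVERY
`q ≥ 2`** (PROVED from Proposition 3.1): `Re(L'(1, χ)/L(1, χ)) > −(1 − 1/√5)·½·log q −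
((1 + 1/√5)·3/2 − 1)` for every primitive `χ` mod `q ≥ 2`; numerically
`> −0.27640·log q − 1.1709`. This is the `𝒮 = ∅` case («including the empty set»).
[cite: Tafula2021, Proposition 3.1 (arXiv p0006:L5–L7)] -/
theorem neg_logDeriv_one_lt (h : tafula2021_proposition31) {q : ℕ} [NeZero q] (hq : 2 ≤ q)
    (χ : DirichletCharacter ℂ q) (hχ : χ.IsPrimitive) :
    -((1 - 1 / Real.sqrt 5) / 2 * Real.log q) - ((1 + 1 / Real.sqrt 5) * 3 / 2 - 1) <
      (deriv χ.LFunction 1 / χ.LFunction 1).re := by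
  have := h q hq χ hχ ∅ (fun _ => 1) (by simp)
  simp only [Finset.sum_empty, mul_zero, zero_add] at this
  linarith

/-- **One real zero: the explicit Siegel-zero dictionary** (PROVED from Proposition 3.1 with
`𝒮 = {β}`): if `β ∈ (0, 1)` is a real zero of `L(s, χ)`, `χ` primitive mod `q ≥ 2`, then
`1/(1 − β) < (1 − 1/√5)·½·log q + Re(L'/L(1, χ)) + (1 + 1/√5)·5/2 − 1`. This is the explicit form of
Granville–Stark's §3.1 Remark 1 (`L'/L(1, χ) = 1/(1 − β) + O(log q)`) used in §3.4 of the source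
(proof of Corollary 1.5) and, with inexplicit constants, in the tree's
`ExceptionalZero.eta_le_of_logDeriv_le`. [cite: Tafula2021, Proposition 3.1 and §3.4 (arXiv
p0006:L5–L7, p0008:L15–L19)] -/
theorem one_div_sub_lt (h : tafula2021_proposition31) {q : ℕ} [NeZero q] (hq : 2 ≤ q)
    (χ : DirichletCharacter ℂ q) (hχ : χ.IsPrimitive) {β : ℝ} (hβ0 : 0 < β) (hβ1 : β < 1)
    (hzero : χ.LFunction β = 0) :
    1 / (1 - β) < (1 - 1 / Real.sqrt 5) / 2 * Real.log q +
      (deriv χ.LFunction 1 / χ.LFunction 1).re + ((1 + 1 / Real.sqrt 5) * 5 / 2 - 1) := by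
  have hχ1 : χ ≠ 1 := ne_one_of_isPrimitive hq hχ
  have hord : 1 ≤ zeroOrder χ (β : ℂ) := by
    have := (zeroOrder_pos_iff χ hχ1 (β : ℂ)).mpr hzero
    omega
  have hS : ∀ ρ ∈ ({(β : ℂ)} : Finset ℂ),
      0 < ρ.re ∧ ρ.re < 1 ∧ 1 ≤ (fun _ => 1 : ℂ → ℕ) ρ ∧ (fun _ => 1 : ℂ → ℕ) ρ ≤ zeroOrder χ ρ := by
    intro ρ hρ
    rw [Finset.mem_singleton] at hρ
    subst hρ
    exact ⟨by simpa using hβ0, by simpa using hβ1, le_rfl, hord⟩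
  have := h q hq χ hχ {(β : ℂ)} (fun _ => 1) hS
  simp only [Finset.sum_singleton, Nat.cast_one, one_mul, mul_one] at this
  have hre : ((1 : ℂ) / (1 - (β : ℂ))).re = 1 / (1 - β) := by
    have : (1 : ℂ) / (1 - (β : ℂ)) = ((1 / (1 - β) : ℝ) : ℂ) := by push_cast; rfl
    rw [this, Complex.ofReal_re]
  rw [hre] at this
  linarith

/-- **Proposition 3.1 implies the asymptotic named fact of the 2025 paper**
(`Literature.NumberTheory.LFunctions.tafula2025_remark23`: `Re L'/L(1, χ) ≥ −½(1 − 1/√5) log q − K`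
for `q ≥ q₀`): take `K = (1 + 1/√5)·3/2 − 1`, `q₀ = 2`. So a discharge of `tafula2021_proposition31`
discharges `tafula2025_remark23` as well. [cite: Tafula2021, Proposition 3.1]
[cite: Tafula2025, Remark 2.3] -/
theorem tafula2025_remark23_of_proposition31 (h : tafula2021_proposition31) :
    tafula2025_remark23 := by
  refine ⟨(1 + 1 / Real.sqrt 5) * 3 / 2 - 1, 2, fun q _ hq χ hχ => ?_⟩
  have hq2 : 2 ≤ q := by exact_mod_cast hq
  have := neg_logDeriv_one_lt h hq2 χ hχ
  have hconst : (1 - 1 / Real.sqrt 5) / 2 * Real.log q =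
      1 / 2 * (1 - 1 / Real.sqrt 5) * Real.log q := by ring
  linarith

/-! ### Small API for the hypotheses -/

/-- On the Page box `ℬ_f`, `Re s > 1/2` as soon as `F ≥ 2` (so its zeros are non-trivial ones).
[cite: Tafula2021, Proposition 3.2 (arXiv p0006:L9–L11)] -/
theorem one_half_lt_re_of_mem_pageBox {F : ℝ} (hF : 2 ≤ F) {s : ℂ} (hs : s ∈ pageBox F) :
    1 / 2 < s.re := by
  have h1 : 1 - 1 / F < s.re := hs.1
  have hFpos : 0 < F := by linarith
  have : 1 / F ≤ 1 / 2 := by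
    rw [div_le_div_iff₀ hFpos two_pos]
    linarith
  linarith

/-- The uniform `abc` statement of the tree
(`Literature.NumberTheory.DiophantineGeometry.UniformABCConjecture`: one constant `C^{[K:ℚ]}`, the
same for all `K`) implies `WeakUniformABCAt ε` for every `ε > 0`: with `C₁ := max |C| 1` one has
`C^{[K:ℚ]} ≤ C₁^{[K:ℚ]}`, and `C₁^{[K:ℚ]} ≤ |D_K|^η` as soon as `rd_K ≥ R₀ := C₁^{1/η}`. This is the
remark «(iii) ⟹ (ii) ⟹ (i)» of the source. [cite: Tafula2021, §5.1, remark after item 5.2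
(arXiv p0012:L31–L33)] -/
theorem weakUniformABCAt_of_uniformABC
    (h : Literature.NumberTheory.DiophantineGeometry.UniformABCConjecture) {ε : ℝ} (hε : 0 < ε) :
    WeakUniformABCAt ε := by
  intro η hη
  obtain ⟨C, hC⟩ := h ε hε
  set C₁ : ℝ := max |C| 1 with hC₁
  have hC₁1 : 1 ≤ C₁ := le_max_right _ _
  have hC₁pos : 0 < C₁ := lt_of_lt_of_le one_pos hC₁1
  refine ⟨C₁ ^ (1 / η), fun K _ _ => ⟨C₁ ^ Module.finrank ℚ K, fun hD => ?_, ?_⟩⟩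
  · -- `C₁^d ≤ |D_K|^η` from `(C₁^{1/η})^d ≤ |D_K|`
    set d : ℕ := Module.finrank ℚ K with hd
    have hpow : 0 ≤ C₁ ^ (d : ℝ) := Real.rpow_nonneg hC₁pos.le _
    have hrew : (C₁ ^ (1 / η)) ^ d = (C₁ ^ (d : ℝ)) ^ (1 / η) := by
      rw [← Real.rpow_natCast, ← Real.rpow_mul hC₁pos.le, ← Real.rpow_mul hC₁pos.le, mul_comm]
    rw [hrew] at hD
    have h2 := Real.rpow_le_rpow (Real.rpow_nonneg hpow _) hD hη.le
    rw [← Real.rpow_mul hpow, one_div_mul_cancel hη.ne', Real.rpow_one, Real.rpow_natCast] at h2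
    exact h2
  · intro a b c ha hb hc habc
    have key := hC K a b c ha hb hc habc
    have hbase : 0 ≤ ((|NumberField.discr K| : ℝ) *
        (Literature.NumberTheory.DiophantineGeometry.radicalNorm a b c : ℝ)) ^ (1 + ε) :=
      Real.rpow_nonneg (mul_nonneg (abs_nonneg _) (Nat.cast_nonneg _)) _
    have hCle : C ^ Module.finrank ℚ K ≤ C₁ ^ Module.finrank ℚ K :=
      calc C ^ Module.finrank ℚ K ≤ |C| ^ Module.finrank ℚ K := by
            rw [← abs_pow]; exact le_abs_self _
        _ ≤ C₁ ^ Module.finrank ℚ K := pow_le_pow_left₀ (abs_nonneg C) (le_max_left _ _) _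
    exact lt_of_lt_of_le key (mul_le_mul_of_nonneg_right hCle hbase)

/-- Hence Granville–Stark's hypothesis (the tree's `UniformABCConjecture`) gives the explicit
zero-free interval of Corollary 1.5 as well, modulo the named fact `tafula2021_corollary15`.
[cite: Tafula2021, Corollary 1.5 and §5.1] -/
theorem zeroFree_of_uniformABC (h15 : tafula2021_corollary15)
    (h : Literature.NumberTheory.DiophantineGeometry.UniformABCConjecture) :
    ∀ ε : ℝ, 0 < ε → ∃ q₀ : ℝ, ∀ (q : ℕ) [NeZero q], q₀ ≤ (q : ℝ) →
      ∀ χ : DirichletCharacter ℂ q, χ.IsQuadratic → χ.IsPrimitive → χ.Odd →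
        ∀ σ : ℝ, 1 - 1 / ((Real.sqrt 5 * ((1 + Real.sqrt 5) / 2) + ε) * Real.log q) ≤ σ →
          χ.LFunction σ ≠ 0 :=
  h15 (fun _ hε => weakUniformABCAt_of_uniformABC h hε)

/-! ### The pairing-up function and Lemma 3.4 (i) (PROVED)

Táfula's pairing-up function (arXiv p0006:L33–L36, eq. (3.3)):
`Π_ε(s) := 1/(s + ε) + 1/(s̄ + ε) + 1/(1 − s + ε) + 1/(1 − s̄ + ε)`, for real `ε`; it is real, and
for `s = σ + it` equals `2(σ + ε)/((σ + ε)² + t²) + 2(1 − σ + ε)/((1 − σ + ε)² + t²)`, which we take as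
the definition. Writing `x = σ(1 − σ)`, `T = t²`, `a_ε = x + ε(1 + ε)`, a two-line computation (the
first display of the proof of Lemma 3.4, p0006:L50–L52) gives the closed form
`Π_ε(s)/2 = (1 + 2ε)(a_ε + T)/(a_ε² + ((1 + 2ε)² − 2a_ε)T + T²)` (`pairing_eq_closedForm`). For
`ε = φ − 1 = (√5 − 1)/2` one has `ε(1 + ε) = 1`, `1 + 2ε = √5`, and the inequality of
**Lemma 3.4 (i)** — «For `0 < Re(s) < 1` and `φ := (1 + √5)/2`, we have `Π₀(s) > Π_{φ−1}(s)/(2φ − 1)`»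
(p0006:L42–L44) — becomes, after clearing the two positive denominators, the polynomial identity
`(x + T)((x + 1)² + (3 − 2x)T + T²) − (x + 1 + T)(x² + (1 − 2x)T + T²) = x² + x + 6xT + T²`, whose
right side is positive for `x > 0`. This is the optimal-constant step behind the `(1 − 1/√5)·½`
of Proposition 3.1 (and of `tafula2025_remark23`), proved here as the first brick of a future
discharge of `tafula2021_proposition31` (the remaining inputs — the Hadamard pair series
`DirichletTheta.logDeriv_xiPair_eq_tsum`, `logDeriv_dirichletXi_eq`, digamma monotonicity and
`|ζ'/ζ(1 + ε)| < 1/ε` for Lemma 3.3 — are tree material, see `RealZeroGlobalLogDerivBound.lean`). -/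

/-- Táfula's **pairing-up function** `Π_ε(s) = 1/(s+ε) + 1/(s̄+ε) + 1/(1−s+ε) + 1/(1−s̄+ε)` (real `ε`),
written directly in its real form `2(σ+ε)/((σ+ε)² + t²) + 2(1−σ+ε)/((1−σ+ε)² + t²)`, `s = σ + it`.
[cite: Tafula2021, §3.1 eq. (3.3) (arXiv p0006:L33–L36)] -/
def pairing (ε : ℝ) (s : ℂ) : ℝ :=
  2 * (s.re + ε) / ((s.re + ε) ^ 2 + s.im ^ 2) + 2 * (1 - s.re + ε) / ((1 - s.re + ε) ^ 2 + s.im ^ 2)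

/-- **Closed form of the pairing function** (first display of the proof of Lemma 3.4): with
`x = σ(1 − σ)`, `T = t²`, `a = x + ε(1 + ε)`,
`Π_ε(s)/2 = (1 + 2ε)(a + T)/(a² + ((1 + 2ε)² − 2a)T + T²)`, provided both denominators of `Π_ε` are
non-zero. [cite: Tafula2021, Lemma 3.4, proof, first display (arXiv p0006:L50–L52)] -/
theorem pairing_eq_closedForm (ε : ℝ) (s : ℂ) (h1 : (s.re + ε) ^ 2 + s.im ^ 2 ≠ 0)
    (h2 : (1 - s.re + ε) ^ 2 + s.im ^ 2 ≠ 0) :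
    pairing ε s / 2 =
      (1 + 2 * ε) * (s.re * (1 - s.re) + ε * (1 + ε) + s.im ^ 2) /
        ((s.re * (1 - s.re) + ε * (1 + ε)) ^ 2 +
          ((1 + 2 * ε) ^ 2 - 2 * (s.re * (1 - s.re) + ε * (1 + ε))) * s.im ^ 2 + (s.im ^ 2) ^ 2) := by
  have hden : (s.re * (1 - s.re) + ε * (1 + ε)) ^ 2 +
      ((1 + 2 * ε) ^ 2 - 2 * (s.re * (1 - s.re) + ε * (1 + ε))) * s.im ^ 2 + (s.im ^ 2) ^ 2 =
      ((s.re + ε) ^ 2 + s.im ^ 2) * ((1 - s.re + ε) ^ 2 + s.im ^ 2) := by ring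
  rw [hden, pairing]
  field_simp
  ring

/-- **Táfula 2021, Lemma 3.4 (i)** (PROVED). «For `0 < Re(s) < 1` and `φ := (1 + √5)/2`, we have
`Π₀(s) > Π_{φ−1}(s)/(2φ − 1)`.» Since `(φ − 1)(1 + (φ − 1)) = 1` and `2φ − 1 = √5 = 1 + 2(φ − 1)`,
after clearing denominators this is the identity
`(x + T)((x+1)² + (3 − 2x)T + T²) − (x + 1 + T)(x² + (1 − 2x)T + T²) = x² + x + 6xT + T² > 0`,
`x = σ(1 − σ) ∈ (0, 1/4]`, `T = t²`. [cite: Tafula2021, Lemma 3.4 (i) (arXiv p0006:L42–L44; proof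
p0006:L53–L58)] -/
theorem pairing_zero_gt (s : ℂ) (hσ0 : 0 < s.re) (hσ1 : s.re < 1) :
    pairing ((1 + Real.sqrt 5) / 2 - 1) s / (2 * ((1 + Real.sqrt 5) / 2) - 1) < pairing 0 s := by
  have h5 : Real.sqrt 5 ^ 2 = 5 := Real.sq_sqrt (by norm_num)
  have h5gt : (2 : ℝ) < Real.sqrt 5 := by
    rw [show (2 : ℝ) = Real.sqrt (2 ^ 2) by rw [Real.sqrt_sq (by norm_num)]]
    exact Real.sqrt_lt_sqrt (by norm_num) (by norm_num)
  have hεpos : 0 < (1 + Real.sqrt 5) / 2 - 1 := by linarith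
  have hεmul : ((1 + Real.sqrt 5) / 2 - 1) * (1 + ((1 + Real.sqrt 5) / 2 - 1)) = 1 := by
    have : ((1 + Real.sqrt 5) / 2 - 1) * (1 + ((1 + Real.sqrt 5) / 2 - 1)) =
        (Real.sqrt 5 ^ 2 - 1) / 4 := by ring
    rw [this, h5]; norm_num
  have h2ε : 1 + 2 * ((1 + Real.sqrt 5) / 2 - 1) = Real.sqrt 5 := by ring
  have h2φ : 2 * ((1 + Real.sqrt 5) / 2) - 1 = Real.sqrt 5 := by ring
  -- the four denominators of `Π₀`, `Π_ε` are non-zero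
  have hd01 : (s.re + 0) ^ 2 + s.im ^ 2 ≠ 0 := by
    have : 0 < (s.re + 0) ^ 2 := by rw [add_zero]; exact pow_pos hσ0 2
    positivity
  have hd02 : (1 - s.re + 0) ^ 2 + s.im ^ 2 ≠ 0 := by
    have : 0 < (1 - s.re + 0) ^ 2 := by rw [add_zero]; exact pow_pos (by linarith) 2
    positivity
  have hdε1 : (s.re + ((1 + Real.sqrt 5) / 2 - 1)) ^ 2 + s.im ^ 2 ≠ 0 := by
    have : 0 < (s.re + ((1 + Real.sqrt 5) / 2 - 1)) ^ 2 := pow_pos (by linarith) 2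
    positivity
  have hdε2 : (1 - s.re + ((1 + Real.sqrt 5) / 2 - 1)) ^ 2 + s.im ^ 2 ≠ 0 := by
    have : 0 < (1 - s.re + ((1 + Real.sqrt 5) / 2 - 1)) ^ 2 := pow_pos (by linarith) 2
    positivity
  have hc0 := pairing_eq_closedForm 0 s hd01 hd02
  have hcε := pairing_eq_closedForm ((1 + Real.sqrt 5) / 2 - 1) s hdε1 hdε2
  rw [hεmul, h2ε, h5] at hcε
  -- name `x = σ(1 − σ)` and `T = t²`
  have hxle : s.re * (1 - s.re) ≤ 1 / 4 := by nlinarith [sq_nonneg (s.re - 1 / 2)]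
  have hxpos : 0 < s.re * (1 - s.re) := mul_pos hσ0 (by linarith)
  obtain ⟨x, hx⟩ : ∃ x : ℝ, s.re * (1 - s.re) = x := ⟨_, rfl⟩
  obtain ⟨T, hT⟩ : ∃ T : ℝ, s.im ^ 2 = T := ⟨_, rfl⟩
  rw [hx, hT] at hc0 hcε
  rw [hx] at hxle hxpos
  have hT0 : 0 ≤ T := by rw [← hT]; positivity
  -- the two closed-form denominators
  have hD₀pos : 0 < x ^ 2 + (1 - 2 * x) * T + T ^ 2 := by
    have : 0 ≤ (1 - 2 * x) * T := mul_nonneg (by linarith) hT0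
    positivity
  have hD₁pos : 0 < (x + 1) ^ 2 + (3 - 2 * x) * T + T ^ 2 := by
    have : 0 ≤ (3 - 2 * x) * T := mul_nonneg (by linarith) hT0
    positivity
  -- `Π₀ = 2 (x + T)/D₀`
  have hP0 : pairing 0 s = 2 * ((x + T) / (x ^ 2 + (1 - 2 * x) * T + T ^ 2)) := by
    have h := hc0
    rw [show (1 + 2 * (0 : ℝ)) * (x + 0 * (1 + 0) + T) = x + T by ring,
      show (x + 0 * (1 + 0)) ^ 2 + ((1 + 2 * (0 : ℝ)) ^ 2 - 2 * (x + 0 * (1 + 0))) * T + T ^ 2 =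
        x ^ 2 + (1 - 2 * x) * T + T ^ 2 by ring] at h
    linarith
  -- `Π_ε = 2 √5 (x + 1 + T)/D₁`
  have hPe : pairing ((1 + Real.sqrt 5) / 2 - 1) s =
      2 * (Real.sqrt 5 * ((x + 1 + T) / ((x + 1) ^ 2 + (3 - 2 * x) * T + T ^ 2))) := by
    have h := hcε
    rw [show (x + 1) ^ 2 + ((5 : ℝ) - 2 * (x + 1)) * T + T ^ 2 =
        (x + 1) ^ 2 + (3 - 2 * x) * T + T ^ 2 by ring, mul_div_assoc] at h
    linarith
  -- the key polynomial identity and the comparison of the two fractions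
  have hkey : (x + T) * ((x + 1) ^ 2 + (3 - 2 * x) * T + T ^ 2) -
      (x + 1 + T) * (x ^ 2 + (1 - 2 * x) * T + T ^ 2) = x ^ 2 + x + 6 * x * T + T ^ 2 := by ring
  have hfrac : (x + 1 + T) / ((x + 1) ^ 2 + (3 - 2 * x) * T + T ^ 2) <
      (x + T) / (x ^ 2 + (1 - 2 * x) * T + T ^ 2) := by
    rw [div_lt_div_iff₀ hD₁pos hD₀pos]
    have : 0 < x ^ 2 + x + 6 * x * T + T ^ 2 := by positivity
    nlinarith [hkey]
  -- conclude
  rw [h2φ, hPe, hP0]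
  have hs5 : 0 < Real.sqrt 5 := by linarith
  rw [show 2 * (Real.sqrt 5 * ((x + 1 + T) / ((x + 1) ^ 2 + (3 - 2 * x) * T + T ^ 2))) / Real.sqrt 5
      = 2 * ((x + 1 + T) / ((x + 1) ^ 2 + (3 - 2 * x) * T + T ^ 2)) by field_simp]
  linarith

end Tafula2021

end Literature.NumberTheory.LFunctions

end
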